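import Literature.NumberTheory.Automorphic.GLnPlaceSplittingCentralizer
import Literature.NumberTheory.Automorphic.GL2SplitTorusOrbitalVanishing
import Literature.NumberTheory.Automorphic.GL2EllipticSplitPlaceLocal
import Literature.NumberTheory.Automorphic.GL2EllipticTorus
import HarnessLib

/-!
# The elliptic classes of `GL₂(K)` split at a finite place contribute nothing for test functions
# supercusp at that place (Gelbart (1975), §10, p. 155, (10.19)–(10.22))

Topic `NumberTheory/Automorphic`; theorems only (no definition, no named fact, no instance visible to
importers).

Gelbart (1975), p. 155: the orbital integral `∫_{B_𝔸 \ G_𝔸} Φ(x⁻¹ γ x) dx` of a factorizable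
`Φ = f_v ⊗ Φ^{(v)}` "is equal to the product of `∫_{B_v \ G_v} f_v(x_v⁻¹ γ x_v) dx_v` and [the integral
away from `v`]" (10.19), and the local factor "equals zero otherwise" (10.20), i.e. (10.22)
`∫_{Z_v \ G_v} (π_v(x_v⁻¹ γ x_v) u_v, u_v) dx_v = 0` when `γ` does not lie in a subfield of `D_v` —
when the quadratic torus of `γ` splits at `v` — "(10.22) is essentially equivalent to the Condition
(10.16)", the supercusp property of `f_v`. Assembling the tree's bricks:

* `GLn.isMulRightInvariant_of_isHaarMeasure_ker` — **`G^{(v)} = ker (g ↦ g_v)` is unimodular**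
  (from the unimodularity of `GL_n(𝔸_K)` and of `GL_n(K_v)` through the splitting
  `GL_n(𝔸_K) ≅ GL_n(K_v) × G^{(v)}` and its Haar factorisation, `GLnPlaceSplitting`).
* `GL2.centralizer_toLocalAt_comm`, `GL2.centralizer_awayFrom_comm` — for an elliptic regular
  `γ ∈ GL₂(K)` the centralisers of its components `γ_v ∈ GL₂(K_v)` and `s(γ) ∈ G^{(v)}` are abelian
  (they embed in the abelian `C(γ_𝔸) = E_𝔸ˣ`, `GL2.centralizer_toAdelic_comm`), hence
  `GL2.exists_smulInvariantMeasure_quotient_centralizer_toLocalAt` / `…_awayFrom`: non-zero invariant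
  measures finite on compact sets exist on `GL₂(K_v) ⧸ C(γ_v)` and `G^{(v)} ⧸ C(s γ)`
  (`InvariantQuotientAbelian`).
* `GL2.integral_descConj_toAdelic_eq_zero_of_isSquare` — **the vanishing**: for `γ ∈ GL₂(K)`
  elliptic regular, a finite place `v` at which `tr(γ)² - 4 det(γ)` is a square in `K_v` (the torus
  `K(γ) ⊗ K_v` splits), any `GL₂(𝔸_K)`-invariant measure `μ` on `GL₂(𝔸_K) ⧸ C(γ_𝔸)` finite on compact
  sets, and any `Φ` on `GL₂(𝔸_K)` factorizable at `v`, `Φ(ι_v(a) k) = ξ(a) Θ(k)`, with `ξ` a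
  continuous supercusp form on `GL₂(K_v)`:
  `∫_{GL₂(𝔸_K) ⧸ C(γ_𝔸)} Φ(y γ_𝔸 y⁻¹) dμ(y) = 0`
  ((10.19) at `v`, `GLn.exists_integral_descConj_eq_smul_mul`; `γ_v = GL.map (K → K_v) γ` is conjugate
  to a regular diagonal matrix, `GL2.exists_map_eq_conj_diagGL2_of_isSquare`,
  `GLn.toLocalAt_gl_toAdelic`; and (10.22), `GL2.integral_descConj_eq_zero_of_conj_diagGL2`).

In the comparison (10.14) = (10.15) this removes the elliptic terms of the `GL₂` side indexed by the
quadratic extensions not embeddable in `D` (those split at some `v ∈ S`, Gelbart (10.17);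
`QuaternionGLTwoClassBijection`), the test function being supercusp at the places of `S`. Part of the
inline (D-0026) decomposition of
`Literature.NumberTheory.Automorphic.strong_multiplicity_one_quaternionUnits`.

## References

* S. Gelbart, *Automorphic forms on adele groups*, Ann. of Math. Studies 83 (1975), §10, p. 155,
  (10.16)–(10.22) [Gelbart1975].
-/

noncomputable section

open MeasureTheory MeasureTheory.Measure Topology NumberField IsDedekindDomain
open scoped NNReal ENNReal

namespace Literature.NumberTheory.Automorphic

open Literature.MeasureTheory.Group

-- the coset spaces carry Borel σ-algebras supplied locally, not the quotient σ-algebra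
attribute [-instance] Quotient.instMeasurableSpace QuotientGroup.measurableSpace

section Split

variable {n : ℕ} {K : Type} [Field K] [NumberField K] {v : HeightOneSpectrum (𝓞 K)}

attribute [local instance] adelicBorel borelSpace_adelic locallyCompactSpace_adelic
  secondCountableTopology_gl_adelic

/-- **`G^{(v)}` is unimodular**: every Haar measure of `G^{(v)} = ker (g ↦ g_v) ≤ GL_n(𝔸_K)` is right
invariant. Proof: with Haar measures `ν` on `GL_n(𝔸_K)` (right invariant,
`GLn.isMulRightInvariant_of_isHaarMeasure_adelic_holds`) and `μ_v` on `GL_n(K_v)`,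
`(splitting⁻¹)_* ν = κ • (μ_v ⊗ μ')` (`GLn.exists_map_placeSplitting_symm_eq_smul_prod`); right
translation by `k₀ ∈ G^{(v)}` is `(a, k) ↦ (a, k k₀)` in the splitting, so `μ_v ⊗ (μ' k₀) = μ_v ⊗ μ'`,
and testing against a compact neighbourhood in `GL_n(K_v)` gives `μ' k₀ = μ'`. [folklore] -/
theorem GLn.isMulRightInvariant_of_isHaarMeasure_ker
    [MeasurableSpace (GL (Fin n) (v.adicCompletion K))] [BorelSpace (GL (Fin n) (v.adicCompletion K))]
    [SecondCountableTopology (GL (Fin n) (v.adicCompletion K))]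
    [LocallyCompactSpace (GL (Fin n) (v.adicCompletion K))]
    (μ' : Measure ((GLn.toLocalAt n K v).ker : Subgroup (AdelicGroupData.gl n K).Adelic)) [IsHaarMeasure μ'] :
    μ'.IsMulRightInvariant := by
  haveI : T2Space (AdelicGroupData.gl n K).Adelic := t2Space_gl n K
  haveI : BorelSpace ((GLn.toLocalAt n K v).ker : Subgroup (AdelicGroupData.gl n K).Adelic) := Subtype.borelSpace _
  haveI : SecondCountableTopology ((GLn.toLocalAt n K v).ker : Subgroup (AdelicGroupData.gl n K).Adelic) :=
    TopologicalSpace.Subtype.secondCountableTopology _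
  haveI : LocallyCompactSpace ((GLn.toLocalAt n K v).ker : Subgroup (AdelicGroupData.gl n K).Adelic) :=
    (GLn.isClosed_ker_toLocalAt (n := n) (K := K) (v := v)).isClosedEmbedding_subtypeVal.locallyCompactSpace
  haveI : SigmaCompactSpace ((GLn.toLocalAt n K v).ker : Subgroup (AdelicGroupData.gl n K).Adelic) :=
    sigmaCompactSpace_of_locallyCompact_secondCountable
  haveI : SFinite μ' := inferInstance
  haveI : BorelSpace (GL (Fin n) (v.adicCompletion K) ×
      ((GLn.toLocalAt n K v).ker : Subgroup (AdelicGroupData.gl n K).Adelic)) := Prod.borelSpace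
  set ν : Measure (AdelicGroupData.gl n K).Adelic := haar with hν
  haveI : ν.IsMulRightInvariant := GLn.isMulRightInvariant_of_isHaarMeasure_adelic_holds n K ν inferInstance
  set μv : Measure (GL (Fin n) (v.adicCompletion K)) := haar with hμv
  obtain ⟨κ, hκ, hmap⟩ := GLn.exists_map_placeSplitting_symm_eq_smul_prod (n := n) (K := K) (v := v) ν μv μ'
  have hmE : Measurable (GLn.placeSplitting n K v).symm := (GLn.placeSplitting n K v).symm.continuous.measurable
  refine ⟨fun k₀ => ?_⟩
  -- right translation by `k₀` in the splitting is `(a, k) ↦ (a, k k₀)`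
  have hcomm : (GLn.placeSplitting n K v).symm ∘ (fun g : (AdelicGroupData.gl n K).Adelic => g * (k₀ : (AdelicGroupData.gl n K).Adelic)) =
      (fun p : GL (Fin n) (v.adicCompletion K) × ((GLn.toLocalAt n K v).ker : Subgroup (AdelicGroupData.gl n K).Adelic) =>
        (p.1, p.2 * k₀)) ∘ (GLn.placeSplitting n K v).symm := by
    funext g
    change (GLn.placeSplitting n K v).symm (g * k₀) = _
    rw [map_mul]
    have hk : (GLn.placeSplitting n K v).symm (k₀ : (AdelicGroupData.gl n K).Adelic) = (1, k₀) :=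
      Prod.ext (MonoidHom.mem_ker.1 k₀.2) (Subtype.ext (GLn.awayFrom_eq_self_of_mem_ker k₀.2))
    rw [hk]
    exact Prod.ext (mul_one _) rfl
  have hR : Measurable fun p : GL (Fin n) (v.adicCompletion K) ×
      ((GLn.toLocalAt n K v).ker : Subgroup (AdelicGroupData.gl n K).Adelic) => (p.1, p.2 * k₀) :=
    measurable_fst.prodMk (measurable_snd.mul_const _)
  have h1 : Measure.map (fun p : GL (Fin n) (v.adicCompletion K) ×
      ((GLn.toLocalAt n K v).ker : Subgroup (AdelicGroupData.gl n K).Adelic) => (p.1, p.2 * k₀))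
      (κ • μv.prod μ') = κ • μv.prod μ' := by
    rw [← hmap, Measure.map_map hR hmE, ← hcomm, ← Measure.map_map hmE (measurable_mul_const _),
      map_mul_right_eq_self]
  have h2 : μv.prod (Measure.map (· * k₀) μ') = μv.prod μ' := by
    have h3 : Measure.map (fun p : GL (Fin n) (v.adicCompletion K) ×
        ((GLn.toLocalAt n K v).ker : Subgroup (AdelicGroupData.gl n K).Adelic) => (p.1, p.2 * k₀)) (μv.prod μ') =
        μv.prod (Measure.map (· * k₀) μ') := by
      rw [show (fun p : GL (Fin n) (v.adicCompletion K) ×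
          ((GLn.toLocalAt n K v).ker : Subgroup (AdelicGroupData.gl n K).Adelic) => (p.1, p.2 * k₀)) =
          Prod.map id (· * k₀) from rfl, ← Measure.map_prod_map _ _ measurable_id (measurable_mul_const _),
        Measure.map_id]
    rw [Measure.map_smul] at h1
    have hκ0 : (κ : ℝ≥0∞) ≠ 0 := by exact_mod_cast hκ.ne'
    refine Measure.ext fun S hS => ?_
    have h4 : (κ : ℝ≥0∞) * (Measure.map (fun p : GL (Fin n) (v.adicCompletion K) ×
        ((GLn.toLocalAt n K v).ker : Subgroup (AdelicGroupData.gl n K).Adelic) => (p.1, p.2 * k₀))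
        (μv.prod μ')) S = κ * (μv.prod μ') S := by
      have := congrArg (fun m : Measure (GL (Fin n) (v.adicCompletion K) ×
        ((GLn.toLocalAt n K v).ker : Subgroup (AdelicGroupData.gl n K).Adelic)) => m S) h1
      simpa only [Measure.coe_nnreal_smul_apply] using this
    rw [h3] at h4
    exact (ENNReal.mul_right_inj hκ0 ENNReal.coe_ne_top).1 h4
  -- test against a compact set of positive finite measure in `GL_n(K_v)`
  obtain ⟨C⟩ : Nonempty (TopologicalSpace.PositiveCompacts (GL (Fin n) (v.adicCompletion K))) := inferInstance
  have hCpos : μv C ≠ 0 := (measure_pos_of_nonempty_interior μv C.interior_nonempty).ne'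
  have hCtop : μv C ≠ ∞ := C.isCompact.measure_lt_top.ne
  refine Measure.ext fun T hT => ?_
  have h5 := congrArg (fun m : Measure (GL (Fin n) (v.adicCompletion K) ×
    ((GLn.toLocalAt n K v).ker : Subgroup (AdelicGroupData.gl n K).Adelic)) => m ((C : Set _) ×ˢ T)) h2
  simp only [Measure.prod_prod] at h5
  exact (ENNReal.mul_right_inj hCpos hCtop).1 h5

/-- **The centraliser of the `v`-component of an elliptic regular `γ ∈ GL₂(K)` is abelian** (its
image under `ι_v` lies in the abelian `C(γ_𝔸)`, `GL2.centralizer_toAdelic_comm`: `ι_v(x)` commutes with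
`s(γ) ∈ G^{(v)}` and with `ι_v(γ_v)`). [folklore] -/
theorem GL2.centralizer_toLocalAt_comm (γ : GL (Fin 2) K)
    (hirr : Irreducible (Matrix.charpoly (γ : Matrix (Fin 2) (Fin 2) K))) :
    ∀ x ∈ Subgroup.centralizer ({GLn.toLocalAt 2 K v ((AdelicGroupData.gl 2 K).toAdelic γ)} :
        Set (GL (Fin 2) (v.adicCompletion K))),
      ∀ y ∈ Subgroup.centralizer ({GLn.toLocalAt 2 K v ((AdelicGroupData.gl 2 K).toAdelic γ)} :
        Set (GL (Fin 2) (v.adicCompletion K))), x * y = y * x := by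
  intro x hx y hy
  have hmem : ∀ z ∈ Subgroup.centralizer ({GLn.toLocalAt 2 K v ((AdelicGroupData.gl 2 K).toAdelic γ)} :
      Set (GL (Fin 2) (v.adicCompletion K))),
      GLn.toAdelic 2 K v z ∈ Subgroup.centralizer ({(AdelicGroupData.gl 2 K).toAdelic γ} :
        Set (AdelicGroupData.gl 2 K).Adelic) := by
    intro z hz
    rw [GLn.mem_centralizer_iff_placeSplitting_symm (v := v)]
    refine ⟨by rwa [GLn.toLocal_toAdelic], ?_⟩
    have h1 : ((GLn.placeSplitting 2 K v).symm (GLn.toAdelic 2 K v z)).2 = 1 :=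
      Subtype.ext (GLn.awayFrom_toAdelic z)
    rw [h1]
    exact Subgroup.one_mem _
  have h := GL2.centralizer_toAdelic_comm K γ hirr _ (hmem x hx) _ (hmem y hy)
  rw [← map_mul, ← map_mul] at h
  exact GLn.toAdelic_injective h

/-- **The centraliser in `G^{(v)}` of the part of an elliptic regular `γ` away from `v` is abelian**
(an element of `G^{(v)}` commuting with `s(γ)` commutes with `γ_𝔸 = ι_v(γ_v) s(γ)`). [folklore] -/
theorem GL2.centralizer_awayFrom_comm (γ : GL (Fin 2) K)
    (hirr : Irreducible (Matrix.charpoly (γ : Matrix (Fin 2) (Fin 2) K))) :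
    ∀ x ∈ Subgroup.centralizer ({((GLn.placeSplitting 2 K v).symm ((AdelicGroupData.gl 2 K).toAdelic γ)).2} :
        Set (GLn.toLocalAt 2 K v).ker),
      ∀ y ∈ Subgroup.centralizer ({((GLn.placeSplitting 2 K v).symm ((AdelicGroupData.gl 2 K).toAdelic γ)).2} :
        Set (GLn.toLocalAt 2 K v).ker), x * y = y * x := by
  intro x hx y hy
  have hmem : ∀ z ∈ Subgroup.centralizer ({((GLn.placeSplitting 2 K v).symm ((AdelicGroupData.gl 2 K).toAdelic γ)).2} :
      Set (GLn.toLocalAt 2 K v).ker),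
      (z : (AdelicGroupData.gl 2 K).Adelic) ∈ Subgroup.centralizer ({(AdelicGroupData.gl 2 K).toAdelic γ} :
        Set (AdelicGroupData.gl 2 K).Adelic) := by
    intro z hz
    rw [GLn.mem_centralizer_iff_placeSplitting_symm (v := v)]
    have hz1 : GLn.toLocalAt 2 K v (z : (AdelicGroupData.gl 2 K).Adelic) = 1 := MonoidHom.mem_ker.1 z.2
    refine ⟨by rw [hz1]; exact Subgroup.one_mem _, ?_⟩
    have h2 : ((GLn.placeSplitting 2 K v).symm (z : (AdelicGroupData.gl 2 K).Adelic)).2 = z :=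
      Subtype.ext (GLn.awayFrom_eq_self_of_mem_ker z.2)
    rwa [h2]
  have h := GL2.centralizer_toAdelic_comm K γ hirr _ (hmem x hx) _ (hmem y hy)
  exact Subtype.ext h

/-- A non-zero `GL₂(K_v)`-invariant measure finite on compact sets exists on `GL₂(K_v) ⧸ C(γ_v)` for
an elliptic regular `γ ∈ GL₂(K)` (abelian closed subgroup of a unimodular group,
`InvariantQuotientAbelian`, `isMulRightInvariant_generalLinearGroup`). [folklore] -/
theorem GL2.exists_smulInvariantMeasure_quotient_centralizer_toLocalAt
    [ValuativeRel (v.adicCompletion K)] [IsNonarchimedeanLocalField (v.adicCompletion K)]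
    [MeasurableSpace (GL (Fin 2) (v.adicCompletion K))] [BorelSpace (GL (Fin 2) (v.adicCompletion K))]
    [SecondCountableTopology (GL (Fin 2) (v.adicCompletion K))]
    (γ : GL (Fin 2) K) (hirr : Irreducible (Matrix.charpoly (γ : Matrix (Fin 2) (Fin 2) K)))
    [MeasurableSpace (GL (Fin 2) (v.adicCompletion K) ⧸
      Subgroup.centralizer ({GLn.toLocalAt 2 K v ((AdelicGroupData.gl 2 K).toAdelic γ)} : Set (GL (Fin 2) (v.adicCompletion K))))]
    [BorelSpace (GL (Fin 2) (v.adicCompletion K) ⧸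
      Subgroup.centralizer ({GLn.toLocalAt 2 K v ((AdelicGroupData.gl 2 K).toAdelic γ)} : Set (GL (Fin 2) (v.adicCompletion K))))] :
    ∃ μv : Measure (GL (Fin 2) (v.adicCompletion K) ⧸
      Subgroup.centralizer ({GLn.toLocalAt 2 K v ((AdelicGroupData.gl 2 K).toAdelic γ)} : Set (GL (Fin 2) (v.adicCompletion K)))),
      SMulInvariantMeasure (GL (Fin 2) (v.adicCompletion K)) _ μv ∧ IsFiniteMeasureOnCompacts μv ∧ μv ≠ 0 := by
  haveI : T2Space (GL (Fin 2) (v.adicCompletion K)) := t2Space_generalLinearGroup (F := v.adicCompletion K) (n := 2)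
  haveI : LocallyCompactSpace (GL (Fin 2) (v.adicCompletion K)) := locallyCompactSpace_generalLinearGroup (F := v.adicCompletion K) (n := 2)
  haveI : SigmaCompactSpace (GL (Fin 2) (v.adicCompletion K)) := sigmaCompactSpace_generalLinearGroup (F := v.adicCompletion K) 2
  set ν : Measure (GL (Fin 2) (v.adicCompletion K)) := haar with hν
  haveI : ν.IsMulRightInvariant := isMulRightInvariant_generalLinearGroup _
  exact exists_smulInvariantMeasure_isFiniteMeasureOnCompacts_quotient_of_comm _ (Set.isClosed_centralizer _)
    (GL2.centralizer_toLocalAt_comm γ hirr) ν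

/-- A non-zero `G^{(v)}`-invariant measure finite on compact sets exists on `G^{(v)} ⧸ C(s γ)` for an
elliptic regular `γ ∈ GL₂(K)` (abelian closed subgroup of the unimodular `G^{(v)}`). [folklore] -/
theorem GL2.exists_smulInvariantMeasure_quotient_centralizer_awayFrom
    [MeasurableSpace (GL (Fin 2) (v.adicCompletion K))] [BorelSpace (GL (Fin 2) (v.adicCompletion K))]
    [SecondCountableTopology (GL (Fin 2) (v.adicCompletion K))] [LocallyCompactSpace (GL (Fin 2) (v.adicCompletion K))]
    (γ : GL (Fin 2) K) (hirr : Irreducible (Matrix.charpoly (γ : Matrix (Fin 2) (Fin 2) K)))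
    [MeasurableSpace ((GLn.toLocalAt 2 K v).ker ⧸
      Subgroup.centralizer ({((GLn.placeSplitting 2 K v).symm ((AdelicGroupData.gl 2 K).toAdelic γ)).2} :
        Set (GLn.toLocalAt 2 K v).ker))]
    [BorelSpace ((GLn.toLocalAt 2 K v).ker ⧸
      Subgroup.centralizer ({((GLn.placeSplitting 2 K v).symm ((AdelicGroupData.gl 2 K).toAdelic γ)).2} :
        Set (GLn.toLocalAt 2 K v).ker))] :
    ∃ μ' : Measure ((GLn.toLocalAt 2 K v).ker ⧸
      Subgroup.centralizer ({((GLn.placeSplitting 2 K v).symm ((AdelicGroupData.gl 2 K).toAdelic γ)).2} :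
        Set (GLn.toLocalAt 2 K v).ker)),
      SMulInvariantMeasure (GLn.toLocalAt 2 K v).ker _ μ' ∧ IsFiniteMeasureOnCompacts μ' ∧ μ' ≠ 0 := by
  haveI : T2Space (AdelicGroupData.gl 2 K).Adelic := t2Space_gl 2 K
  haveI : BorelSpace ((GLn.toLocalAt 2 K v).ker : Subgroup (AdelicGroupData.gl 2 K).Adelic) := Subtype.borelSpace _
  haveI : SecondCountableTopology ((GLn.toLocalAt 2 K v).ker : Subgroup (AdelicGroupData.gl 2 K).Adelic) :=
    TopologicalSpace.Subtype.secondCountableTopology _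
  haveI : LocallyCompactSpace ((GLn.toLocalAt 2 K v).ker : Subgroup (AdelicGroupData.gl 2 K).Adelic) :=
    (GLn.isClosed_ker_toLocalAt (n := 2) (K := K) (v := v)).isClosedEmbedding_subtypeVal.locallyCompactSpace
  set ν : Measure ((GLn.toLocalAt 2 K v).ker : Subgroup (AdelicGroupData.gl 2 K).Adelic) := haar with hν
  haveI : ν.IsMulRightInvariant := GLn.isMulRightInvariant_of_isHaarMeasure_ker ν
  exact exists_smulInvariantMeasure_isFiniteMeasureOnCompacts_quotient_of_comm _ (Set.isClosed_centralizer _)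
    (GL2.centralizer_awayFrom_comm γ hirr) ν

/-- **Gelbart's (10.19) + (10.22): the class term of an elliptic class split at `v` vanishes for test
functions supercusp at `v`.** Let `γ ∈ GL₂(K)` have irreducible characteristic polynomial, let `v`
be a finite place at which `tr(γ)² - 4 det(γ)` is a square in `K_v` (i.e. `K(γ) ⊗_K K_v` is not a
field), let `μ` be a `GL₂(𝔸_K)`-invariant measure on `GL₂(𝔸_K) ⧸ C(γ_𝔸)` finite on compact sets, and let
`Φ` on `GL₂(𝔸_K)` be factorizable at `v`, `Φ(ι_v(a) k) = ξ(a) Θ(k)` (`a ∈ GL₂(K_v)`, `k ∈ G^{(v)}`), with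
`ξ` continuous and supercusp (`∫ ξ(a n(x) b) dx = 0`). Then `∫_{GL₂(𝔸_K) ⧸ C(γ_𝔸)} Φ(y γ_𝔸 y⁻¹) dμ(y) = 0`:
the orbital integral is `c · (∫_{G_v/C(γ_v)} ξ(a γ_v a⁻¹)) · (∫_{G^{(v)}/C(sγ)} Θ(…))`
(`GLn.exists_integral_descConj_eq_smul_mul`), `γ_v = GL.map (K → K_v) γ = g d(m₀, m₁) g⁻¹` with
`m₀ ≠ m₁` (`GLn.toLocalAt_gl_toAdelic`, `GL2.exists_map_eq_conj_diagGL2_of_isSquare`), and the local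
factor vanishes (`GL2.integral_descConj_eq_zero_of_conj_diagGL2`). [cite: Gelbart1975, p. 155 (10.19)–(10.22)] -/
theorem GL2.integral_descConj_toAdelic_eq_zero_of_isSquare
    [ValuativeRel (v.adicCompletion K)] [IsNonarchimedeanLocalField (v.adicCompletion K)]
    [MeasurableSpace (v.adicCompletion K)] [BorelSpace (v.adicCompletion K)]
    [MeasurableSpace (GL (Fin 2) (v.adicCompletion K))] [BorelSpace (GL (Fin 2) (v.adicCompletion K))]
    [SecondCountableTopology (GL (Fin 2) (v.adicCompletion K))]
    (γ : GL (Fin 2) K) (hirr : Irreducible (Matrix.charpoly (γ : Matrix (Fin 2) (Fin 2) K)))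
    (hsq : IsSquare (algebraMap K (v.adicCompletion K)
      ((γ : Matrix (Fin 2) (Fin 2) K).trace ^ 2 - 4 * (γ : Matrix (Fin 2) (Fin 2) K).det)))
    [MeasurableSpace ((AdelicGroupData.gl 2 K).Adelic ⧸
      Subgroup.centralizer ({(AdelicGroupData.gl 2 K).toAdelic γ} : Set (AdelicGroupData.gl 2 K).Adelic))]
    [BorelSpace ((AdelicGroupData.gl 2 K).Adelic ⧸
      Subgroup.centralizer ({(AdelicGroupData.gl 2 K).toAdelic γ} : Set (AdelicGroupData.gl 2 K).Adelic))]
    (μ : Measure ((AdelicGroupData.gl 2 K).Adelic ⧸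
      Subgroup.centralizer ({(AdelicGroupData.gl 2 K).toAdelic γ} : Set (AdelicGroupData.gl 2 K).Adelic)))
    [SMulInvariantMeasure (AdelicGroupData.gl 2 K).Adelic _ μ] [IsFiniteMeasureOnCompacts μ]
    {Φ : (AdelicGroupData.gl 2 K).Adelic → ℂ} {ξ : GL (Fin 2) (v.adicCompletion K) → ℂ}
    {Θ : (GLn.toLocalAt 2 K v).ker → ℂ}
    (hΦ : ∀ (a : GL (Fin 2) (v.adicCompletion K)) (k : (GLn.toLocalAt 2 K v).ker),
      Φ (GLn.toAdelic 2 K v a * (k : (AdelicGroupData.gl 2 K).Adelic)) = ξ a * Θ k)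
    (hξc : Continuous ξ)
    (hξ : ∀ (dx : Measure (v.adicCompletion K)) [dx.IsAddHaarMeasure] (a b : GL (Fin 2) (v.adicCompletion K)),
      ∫ x, ξ (a * ((unipotentGL2 x : ↥(upperUnitriangular (Fin 2) (v.adicCompletion K))) :
        GL (Fin 2) (v.adicCompletion K)) * b) ∂dx = 0) :
    ∫ y, descConj ((AdelicGroupData.gl 2 K).toAdelic γ)
      (Subgroup.centralizer ({(AdelicGroupData.gl 2 K).toAdelic γ} : Set (AdelicGroupData.gl 2 K).Adelic))
      (Literature.MeasureTheory.Group.centralizer_comm _) Φ y ∂μ = 0 := by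
  haveI : T2Space (AdelicGroupData.gl 2 K).Adelic := t2Space_gl 2 K
  haveI : T2Space (GL (Fin 2) (v.adicCompletion K)) := t2Space_generalLinearGroup (F := v.adicCompletion K) (n := 2)
  haveI : LocallyCompactSpace (GL (Fin 2) (v.adicCompletion K)) := locallyCompactSpace_generalLinearGroup (F := v.adicCompletion K) (n := 2)
  by_cases hμ : μ = 0
  · rw [hμ, integral_zero_measure]
  -- Borel structures on the two factor quotients, and non-zero invariant measures on them
  letI : MeasurableSpace (GL (Fin 2) (v.adicCompletion K) ⧸
      Subgroup.centralizer ({GLn.toLocalAt 2 K v ((AdelicGroupData.gl 2 K).toAdelic γ)} :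
        Set (GL (Fin 2) (v.adicCompletion K)))) := borel _
  haveI : BorelSpace (GL (Fin 2) (v.adicCompletion K) ⧸
      Subgroup.centralizer ({GLn.toLocalAt 2 K v ((AdelicGroupData.gl 2 K).toAdelic γ)} :
        Set (GL (Fin 2) (v.adicCompletion K)))) := ⟨rfl⟩
  letI : MeasurableSpace ((GLn.toLocalAt 2 K v).ker ⧸
      Subgroup.centralizer ({((GLn.placeSplitting 2 K v).symm ((AdelicGroupData.gl 2 K).toAdelic γ)).2} :
        Set (GLn.toLocalAt 2 K v).ker)) := borel _
  haveI : BorelSpace ((GLn.toLocalAt 2 K v).ker ⧸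
      Subgroup.centralizer ({((GLn.placeSplitting 2 K v).symm ((AdelicGroupData.gl 2 K).toAdelic γ)).2} :
        Set (GLn.toLocalAt 2 K v).ker)) := ⟨rfl⟩
  obtain ⟨μv, hμv1, hμv2, hμv3⟩ := GL2.exists_smulInvariantMeasure_quotient_centralizer_toLocalAt (v := v) γ hirr
  obtain ⟨μ', hμ'1, hμ'2, hμ'3⟩ := GL2.exists_smulInvariantMeasure_quotient_centralizer_awayFrom (v := v) γ hirr
  haveI := hμv1
  haveI := hμv2
  haveI := hμ'1
  haveI := hμ'2
  haveI : BorelSpace ((GLn.toLocalAt 2 K v).ker : Subgroup (AdelicGroupData.gl 2 K).Adelic) := Subtype.borelSpace _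
  haveI : SecondCountableTopology ((GLn.toLocalAt 2 K v).ker : Subgroup (AdelicGroupData.gl 2 K).Adelic) :=
    TopologicalSpace.Subtype.secondCountableTopology _
  haveI : LocallyCompactSpace ((GLn.toLocalAt 2 K v).ker : Subgroup (AdelicGroupData.gl 2 K).Adelic) :=
    (GLn.isClosed_ker_toLocalAt (n := 2) (K := K) (v := v)).isClosedEmbedding_subtypeVal.locallyCompactSpace
  haveI : IsLocallyFiniteMeasure μv := isLocallyFiniteMeasure_of_isFiniteMeasureOnCompacts
  haveI : SigmaFinite μv := sigmaFinite_of_locallyFinite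
  haveI : IsLocallyFiniteMeasure μ' := isLocallyFiniteMeasure_of_isFiniteMeasureOnCompacts
  haveI : SigmaFinite μ' := sigmaFinite_of_locallyFinite
  -- (10.19) at `v`
  obtain ⟨c, -, hc⟩ := GLn.exists_integral_descConj_eq_smul_mul (n := 2) (K := K) (v := v)
    ((AdelicGroupData.gl 2 K).toAdelic γ) (Set.isClosed_centralizer _) (Set.isClosed_centralizer _) μ μv μ'
    hμ hμv3 hμ'3
  rw [hc Φ ξ Θ hΦ]
  -- (10.22): the local factor vanishes, `γ_v` being conjugate to a regular diagonal matrix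
  haveI : CharZero (v.adicCompletion K) :=
    charZero_of_injective_algebraMap (algebraMap K (v.adicCompletion K)).injective
  haveI : SecondCountableTopology (v.adicCompletion K) := secondCountableTopology_adicCompletion K v
  obtain ⟨m₀, m₁, g, hne, hγv⟩ := GL2.exists_map_eq_conj_diagGL2_of_isSquare (L := v.adicCompletion K) γ hirr hsq
  rw [← GLn.toLocalAt_gl_toAdelic 2 K v γ] at hγv
  rw [GL2.integral_descConj_eq_zero_of_conj_diagGL2 hne g hγv μv hξc hξ, zero_mul, smul_zero]

end Split

end Literature.NumberTheory.Automorphic
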